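import Literature.Topology.FourManifolds.SphereFamilySurgery
import Literature.Topology.FourManifolds.GluckTwistUnknotProofs
import Literature.Topology.FourManifolds.CircleSurgeryConnectedSum
import HarnessLib

/-!
# The local model of the `0`-surgery along a framed `S⁰` in a `3`-manifold:
# `S² × S¹` minus a point is `ℝ³` surgered along two standard balls

Topic `Literature/Topology/FourManifolds`.  First file of the proof of the classical lemma
*"surgery of type `(1, 3)` (a `0`-surgery, `S⁰ × D³ ↝ D¹ × S²`) along an orientably framed
`S⁰` in a connected `3`-manifold `Z` gives `Z # (S² × S¹)`"* (A. Kosinski, *Differential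
Manifolds* (1993), VI §9 with VI (3.1), (6.6); J. Milnor, *Lectures on the h-cobordism theorem*
(1965), Def. 3.11 and Thm. 3.13), the one-handle step of "the boundary of `♮ⁿ S¹ × B³` is
`#ⁿ(S² × S¹)`" (R. C. Kirby, *The topology of 4-manifolds* (1989), Ch. I §2, p. 8;
`OneHandlebodyBoundarySum.lean`).

This file is the explicit MODEL, the analogue for `S⁰ ⊂ ℝ³` of
`CircleSurgeryStandardModel{,Gluing}.lean` (`S² × S²` minus a point is the surgery of `ℝ⁴`
along the standard framed circle).  Think of `S³ = ℝ³ ∪ ∞` with the two feet of the `S⁰` at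
`0` and `∞`, framed by the round ball `t u ↦ (t/4) u` at `0` and the inverted round ball
`t u ↦ (8/t) u` at `∞` (`u ∈ S²`, `0 ≤ t < 1`); the surgery removes the two feet and glues in
the neck `(-1, 1) × S²` along Milnor's identification `(t/4) u ∼ (t, u)`, `(8/t) u ∼ (-t, u)`.
The result is visibly `S² × S¹`: a point `x ≠ 0` of `ℝ³` is sent to
`(x/‖x‖, P(B ‖x‖)) ∈ S² × S¹` where `B ρ = 1/(4ρ) - ρ/8` is a decreasing diffeomorphism
`(0, ∞) ≅ ℝ` (explicit inverse `√(16 s² + 2) - 4 s`) and `P s = ((s² - 1)/(s² + 1), 2s/(s² + 1))`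
is the rational parametrisation of the circle minus the point `(1, 0)`; the neck point
`(τ, u)` is sent to `(u, P'(32 τ/(32 - τ²)))` with `P' y = ((1 - y²)/(1 + y²), 2y/(1 + y²))` the
rational parametrisation of the circle minus `(-1, 0)` (so that `P' y = P (1/y)`); the
anti-symmetry `B (2/ρ) = -B ρ` of the profile makes the two feet match the two ends of ONE
smooth neck map.  The third point `∞ ∈ S³`, read as the point `q = (3/2, 0, 0)` of the shell
between the two balls, is the point of `S² × S¹` at which the connected sum with `Z` will be
taken (`ZeroSphereSurgeryConnectedSum.lean`).

* §1 the circle parametrisations `cirP`, `cirP'` and their inverses; §2 the profile `B`;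
* §3 `modelH : ℝ³ ∖ 0 ⇀ S² × S¹` and §4 `modelNeck : (-1,1) × S² ⇀ S² × S¹` (the neck typed
  as the tree's new piece `ballTimesSphere Unit 0 2` of `SphereFamilySurgery.lean`), globally
  defined partial diffeomorphisms with explicit algebraic inverses;
* §5 the gluing identities and the analysis of `modelH x = modelNeck b`;
* §6 **`ZeroSphereModel.isOpenGluing_model`**: `(S² × S¹) ∖ {H q}` is the open gluing
  (`IsOpenGluing`) of `ℝ³ ∖ {0, q}` and the neck along the model relation `modelRel`.

Everything here is proved; no named facts are introduced.

## References

* A. A. Kosinski, *Differential Manifolds*, Academic Press (1993), VI §9, VI (3.1), (6.6).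
  [Kosinski1993]
* J. Milnor, *Lectures on the h-cobordism theorem* (1965), Def. 3.11, Thm. 3.13.
  [MilnorHCobordism1965]
* R. C. Kirby, *The topology of 4-manifolds*, LNM 1374 (1989), Ch. I §2, p. 8. [Kirby1989]
-/

open scoped Manifold ContDiff Topology
open Set Function Metric

noncomputable section

namespace Literature.Topology.FourManifolds

/-- Local notation: `𝔼 n` is the model Euclidean space `EuclideanSpace ℝ (Fin n)`. -/
local notation "𝔼 " n:arg => EuclideanSpace ℝ (Fin n)

/-- Local notation: `𝕊 n` is the unit sphere in `EuclideanSpace ℝ (Fin (n + 1))`. -/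
local notation "𝕊 " n:arg => (Metric.sphere (0 : EuclideanSpace ℝ (Fin (n + 1))) 1)

namespace ZeroSphereModel

open GluckUnknot (sphereProj coe_sphereProj sphereProj_smul_coe contDiffOn_normalize)

attribute [local instance] fact_finrank_euclideanSpace_succ

/-! ### §1 Two rational parametrisations of the circle -/

/-- `P s = ((s² - 1)/(s² + 1), 2 s/(s² + 1))`, the rational parametrisation of the unit circle
minus the point `(1, 0)`, as a vector of `ℝ²`. [folklore] -/
def cirA (s : ℝ) : 𝔼 2 := WithLp.toLp 2 ![(s ^ 2 - 1) / (s ^ 2 + 1), 2 * s / (s ^ 2 + 1)]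

/-- `P' y = ((1 - y²)/(1 + y²), 2 y/(1 + y²))`, the rational parametrisation of the unit circle
minus the point `(-1, 0)`, as a vector of `ℝ²`. [folklore] -/
def cirB (y : ℝ) : 𝔼 2 := WithLp.toLp 2 ![(1 - y ^ 2) / (1 + y ^ 2), 2 * y / (1 + y ^ 2)]

/-- First coordinate of `P s`. [folklore] -/
@[simp] theorem cirA_apply_zero (s : ℝ) : cirA s 0 = (s ^ 2 - 1) / (s ^ 2 + 1) := rfl
/-- Second coordinate of `P s`. [folklore] -/
@[simp] theorem cirA_apply_one (s : ℝ) : cirA s 1 = 2 * s / (s ^ 2 + 1) := rfl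
/-- First coordinate of `P' y`. [folklore] -/
@[simp] theorem cirB_apply_zero (y : ℝ) : cirB y 0 = (1 - y ^ 2) / (1 + y ^ 2) := rfl
/-- Second coordinate of `P' y`. [folklore] -/
@[simp] theorem cirB_apply_one (y : ℝ) : cirB y 1 = 2 * y / (1 + y ^ 2) := rfl

/-- `‖P s‖ = 1`. [folklore] -/
theorem norm_cirA (s : ℝ) : ‖cirA s‖ = 1 := by
  have h : ‖cirA s‖ ^ 2 = 1 := by
    rw [StdCircleSurgery.norm_sq_two, cirA_apply_zero, cirA_apply_one]
    have : (s ^ 2 + 1) ≠ 0 := by positivity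
    field_simp
    ring
  have h0 : 0 ≤ ‖cirA s‖ := norm_nonneg _
  nlinarith [h, h0]

/-- `‖P' y‖ = 1`. [folklore] -/
theorem norm_cirB (y : ℝ) : ‖cirB y‖ = 1 := by
  have h : ‖cirB y‖ ^ 2 = 1 := by
    rw [StdCircleSurgery.norm_sq_two, cirB_apply_zero, cirB_apply_one]
    have : (1 + y ^ 2) ≠ 0 := by positivity
    field_simp
    ring
  have h0 : 0 ≤ ‖cirB y‖ := norm_nonneg _
  nlinarith [h, h0]

/-- `P s` as a point of `S¹`. [folklore] -/
def cirP (s : ℝ) : 𝕊 1 := ⟨cirA s, by simp [norm_cirA s]⟩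

/-- `P' y` as a point of `S¹`. [folklore] -/
def cirP' (y : ℝ) : 𝕊 1 := ⟨cirB y, by simp [norm_cirB y]⟩

/-- `P s` in coordinates. [folklore] -/
@[simp] theorem coe_cirP (s : ℝ) : (cirP s : 𝔼 2) = cirA s := rfl
/-- `P' y` in coordinates. [folklore] -/
@[simp] theorem coe_cirP' (y : ℝ) : (cirP' y : 𝔼 2) = cirB y := rfl

/-- `P' y = P (1/y)` for `y ≠ 0`. [folklore] -/
theorem cirB_eq_cirA_inv {y : ℝ} (hy : y ≠ 0) : cirB y = cirA y⁻¹ := by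
  ext i
  fin_cases i
  · show (1 - y ^ 2) / (1 + y ^ 2) = ((y⁻¹) ^ 2 - 1) / ((y⁻¹) ^ 2 + 1)
    field_simp
  · show 2 * y / (1 + y ^ 2) = 2 * y⁻¹ / ((y⁻¹) ^ 2 + 1)
    field_simp

/-- `P' y = P (1/y)` on the circle, for `y ≠ 0`. [folklore] -/
theorem cirP'_eq_cirP_inv {y : ℝ} (hy : y ≠ 0) : cirP' y = cirP y⁻¹ :=
  Subtype.ext (cirB_eq_cirA_inv hy)

/-- `(P s)₀ < 1`: `P` misses the point `(1, 0)`. [folklore] -/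
theorem cirA_apply_zero_lt_one (s : ℝ) : cirA s 0 < 1 := by
  rw [cirA_apply_zero, div_lt_one (by positivity)]
  linarith

/-- `-1 < (P' y)₀`: `P'` misses the point `(-1, 0)`. [folklore] -/
theorem neg_one_lt_cirB_apply_zero (y : ℝ) : -1 < cirB y 0 := by
  rw [cirB_apply_zero, lt_div_iff₀ (by positivity)]
  nlinarith [sq_nonneg y]

/-- `(P' 0) = (1, 0)`: `(P' 0)₀ = 1`. [folklore] -/
theorem cirB_zero_apply_zero : cirB 0 0 = 1 := by simp

/-- `(P' y)₀ = 1` only for `y = 0`. [folklore] -/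
theorem cirB_apply_zero_eq_one_iff (y : ℝ) : cirB y 0 = 1 ↔ y = 0 := by
  rw [cirB_apply_zero, div_eq_one_iff_eq (by positivity)]
  constructor
  · intro h; nlinarith [sq_nonneg y]
  · rintro rfl; simp

/-- The inverse of `P`: `S p = p₁/(1 - p₀)`. [folklore] -/
def cirS (p : 𝔼 2) : ℝ := p 1 / (1 - p 0)

/-- The inverse of `P'`: `T p = p₁/(1 + p₀)`. [folklore] -/
def cirT (p : 𝔼 2) : ℝ := p 1 / (1 + p 0)

/-- `S (P s) = s`. [folklore] -/
theorem cirS_cirA (s : ℝ) : cirS (cirA s) = s := by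
  rw [cirS, cirA_apply_zero, cirA_apply_one]
  have : (s ^ 2 + 1) ≠ 0 := by positivity
  field_simp
  ring

/-- `T (P' y) = y`. [folklore] -/
theorem cirT_cirB (y : ℝ) : cirT (cirB y) = y := by
  rw [cirT, cirB_apply_zero, cirB_apply_one]
  have : (1 + y ^ 2) ≠ 0 := by positivity
  field_simp
  ring

/-- `P (S p) = p` for a unit vector `p ≠ (1, 0)`. [folklore] -/
theorem cirA_cirS {p : 𝔼 2} (hp : ‖p‖ = 1) (hp0 : p 0 ≠ 1) : cirA (cirS p) = p := by
  have h1 : p 0 ^ 2 + p 1 ^ 2 = 1 := by rw [← StdCircleSurgery.norm_sq_two, hp, one_pow]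
  have hne : 1 - p 0 ≠ 0 := sub_ne_zero.2 (Ne.symm hp0)
  have hden : (p 1 / (1 - p 0)) ^ 2 + 1 = 2 / (1 - p 0) := by
    field_simp
    nlinarith [h1]
  have h2 : (2 : ℝ) / (1 - p 0) ≠ 0 := div_ne_zero two_ne_zero hne
  ext i
  fin_cases i
  · show ((p 1 / (1 - p 0)) ^ 2 - 1) / ((p 1 / (1 - p 0)) ^ 2 + 1) = p 0
    rw [hden, div_eq_iff h2]
    field_simp
    nlinarith [h1]
  · show 2 * (p 1 / (1 - p 0)) / ((p 1 / (1 - p 0)) ^ 2 + 1) = p 1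
    rw [hden]
    field_simp

/-- `P' (T p) = p` for a unit vector `p ≠ (-1, 0)`. [folklore] -/
theorem cirB_cirT {p : 𝔼 2} (hp : ‖p‖ = 1) (hp0 : p 0 ≠ -1) : cirB (cirT p) = p := by
  have h1 : p 0 ^ 2 + p 1 ^ 2 = 1 := by rw [← StdCircleSurgery.norm_sq_two, hp, one_pow]
  have hne : 1 + p 0 ≠ 0 := fun h => hp0 (by linarith)
  have hden : 1 + (p 1 / (1 + p 0)) ^ 2 = 2 / (1 + p 0) := by
    field_simp
    nlinarith [h1]
  have h2 : (2 : ℝ) / (1 + p 0) ≠ 0 := div_ne_zero two_ne_zero hne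
  ext i
  fin_cases i
  · show (1 - (p 1 / (1 + p 0)) ^ 2) / (1 + (p 1 / (1 + p 0)) ^ 2) = p 0
    rw [hden, div_eq_iff h2]
    field_simp
    nlinarith [h1]
  · show 2 * (p 1 / (1 + p 0)) / (1 + (p 1 / (1 + p 0)) ^ 2) = p 1
    rw [hden]
    field_simp

/-- `P` is injective. [folklore] -/
theorem cirA_injective : Injective cirA := fun s s' h => by
  have h' := congrArg cirS h
  rwa [cirS_cirA, cirS_cirA] at h'

/-- `P` is injective on the circle. [folklore] -/
theorem cirP_injective : Injective cirP := fun _ _ h =>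
  cirA_injective (congrArg (fun p : 𝕊 1 => (p : 𝔼 2)) h)

/-- `P` is smooth. [folklore] -/
theorem contDiff_cirA : ContDiff ℝ ∞ cirA := by
  rw [contDiff_euclidean]
  intro i
  fin_cases i
  · show ContDiff ℝ ∞ fun s : ℝ => (s ^ 2 - 1) / (s ^ 2 + 1)
    exact ((contDiff_id.pow 2).sub contDiff_const).div ((contDiff_id.pow 2).add contDiff_const)
      fun s => by positivity
  · show ContDiff ℝ ∞ fun s : ℝ => 2 * s / (s ^ 2 + 1)
    exact (contDiff_const.mul contDiff_id).div ((contDiff_id.pow 2).add contDiff_const)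
      fun s => by positivity

/-- `P'` is smooth. [folklore] -/
theorem contDiff_cirB : ContDiff ℝ ∞ cirB := by
  rw [contDiff_euclidean]
  intro i
  fin_cases i
  · show ContDiff ℝ ∞ fun y : ℝ => (1 - y ^ 2) / (1 + y ^ 2)
    exact (contDiff_const.sub (contDiff_id.pow 2)).div (contDiff_const.add (contDiff_id.pow 2))
      fun y => by positivity
  · show ContDiff ℝ ∞ fun y : ℝ => 2 * y / (1 + y ^ 2)
    exact (contDiff_const.mul contDiff_id).div (contDiff_const.add (contDiff_id.pow 2))
      fun y => by positivity

/-- `P` is smooth as a map into the circle. [folklore] -/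
theorem contMDiff_cirP : ContMDiff 𝓘(ℝ, ℝ) (𝓡 1) ∞ cirP :=
  contDiff_cirA.contMDiff.codRestrict_sphere fun s => (cirP s).2

/-- `P'` is smooth as a map into the circle. [folklore] -/
theorem contMDiff_cirP' : ContMDiff 𝓘(ℝ, ℝ) (𝓡 1) ∞ cirP' :=
  contDiff_cirB.contMDiff.codRestrict_sphere fun y => (cirP' y).2

/-- `S` is smooth off the line `p₀ = 1`. [folklore] -/
theorem contDiffAt_cirS {p : 𝔼 2} (hp : p 0 ≠ 1) : ContDiffAt ℝ ∞ cirS p := by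
  have h0 : ContDiff ℝ ∞ fun p : 𝔼 2 => p 0 :=
    (EuclideanSpace.proj (0 : Fin 2) : 𝔼 2 →L[ℝ] ℝ).contDiff
  have h1 : ContDiff ℝ ∞ fun p : 𝔼 2 => p 1 :=
    (EuclideanSpace.proj (1 : Fin 2) : 𝔼 2 →L[ℝ] ℝ).contDiff
  exact h1.contDiffAt.div (contDiff_const.sub h0).contDiffAt (sub_ne_zero.2 (Ne.symm hp))

/-- `T` is smooth off the line `p₀ = -1`. [folklore] -/
theorem contDiffAt_cirT {p : 𝔼 2} (hp : p 0 ≠ -1) : ContDiffAt ℝ ∞ cirT p := by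
  have h0 : ContDiff ℝ ∞ fun p : 𝔼 2 => p 0 :=
    (EuclideanSpace.proj (0 : Fin 2) : 𝔼 2 →L[ℝ] ℝ).contDiff
  have h1 : ContDiff ℝ ∞ fun p : 𝔼 2 => p 1 :=
    (EuclideanSpace.proj (1 : Fin 2) : 𝔼 2 →L[ℝ] ℝ).contDiff
  exact h1.contDiffAt.div (contDiff_const.add h0).contDiffAt fun h => hp (by linarith)

/-! ### §2 The radial profile `B ρ = 1/(4ρ) - ρ/8` and its inverse -/

/-- The radial profile `B ρ = 1/(4ρ) - ρ/8`, a decreasing diffeomorphism `(0, ∞) ≅ ℝ` with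
`B (τ/4) = 1/τ - τ/32` and `B (8/t) = t/32 - 1/t` (anti-symmetry `B (2/ρ) = -B ρ`). [folklore] -/
def profB (ρ : ℝ) : ℝ := 1 / (4 * ρ) - ρ / 8

/-- The inverse profile `B⁻¹ s = √(16 s² + 2) - 4 s`. [folklore] -/
def profBinv (s : ℝ) : ℝ := Real.sqrt (16 * s ^ 2 + 2) - 4 * s

/-- `B (τ/4) = 1/τ - τ/32`. [folklore] -/
theorem profB_div_four {τ : ℝ} (hτ : τ ≠ 0) : profB (τ / 4) = 1 / τ - τ / 32 := by
  rw [profB]; field_simp; ring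

/-- `B (8/t) = t/32 - 1/t`. [folklore] -/
theorem profB_eight_div {t : ℝ} (ht : t ≠ 0) : profB (8 / t) = t / 32 - 1 / t := by
  rw [profB]; field_simp; ring

/-- `B⁻¹ s > 0`. [folklore] -/
theorem profBinv_pos (s : ℝ) : 0 < profBinv s := by
  rw [profBinv, sub_pos]
  have h1 : (4 * s) ^ 2 < 16 * s ^ 2 + 2 := by nlinarith
  by_cases hs : 4 * s < 0
  · exact lt_of_lt_of_le hs (Real.sqrt_nonneg _)
  · rw [not_lt] at hs
    calc 4 * s = Real.sqrt ((4 * s) ^ 2) := (Real.sqrt_sq hs).symm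
      _ < Real.sqrt (16 * s ^ 2 + 2) := Real.sqrt_lt_sqrt (sq_nonneg _) h1

/-- `B (B⁻¹ s) = s`. [folklore] -/
theorem profB_profBinv (s : ℝ) : profB (profBinv s) = s := by
  have hpos := profBinv_pos s
  have hR : Real.sqrt (16 * s ^ 2 + 2) ^ 2 = 16 * s ^ 2 + 2 := Real.sq_sqrt (by positivity)
  -- `ρ² + 8 s ρ - 2 = 0` for `ρ = B⁻¹ s`
  have hq : profBinv s ^ 2 + 8 * s * profBinv s - 2 = 0 := by
    rw [profBinv]; nlinarith [hR]
  rw [profB]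
  field_simp
  nlinarith [hq]

/-- `B⁻¹ (B ρ) = ρ` for `ρ > 0`. [folklore] -/
theorem profBinv_profB {ρ : ℝ} (hρ : 0 < ρ) : profBinv (profB ρ) = ρ := by
  have h1 : 16 * (profB ρ) ^ 2 + 2 = (ρ / 2 + 1 / ρ) ^ 2 := by
    rw [profB]; field_simp; ring
  have h2 : 0 ≤ ρ / 2 + 1 / ρ := by positivity
  rw [profBinv, h1, Real.sqrt_sq h2, profB]
  field_simp
  ring

/-- `B` is injective on `(0, ∞)`. [folklore] -/
theorem profB_injOn : InjOn profB (Ioi 0) := fun ρ hρ ρ' hρ' h => by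
  rw [← profBinv_profB (mem_Ioi.1 hρ), h, profBinv_profB (mem_Ioi.1 hρ')]

/-- `B` is smooth off `0`. [folklore] -/
theorem contDiffAt_profB {ρ : ℝ} (hρ : ρ ≠ 0) : ContDiffAt ℝ ∞ profB ρ := by
  have h : ContDiffAt ℝ ∞ (fun ρ : ℝ => 1 / (4 * ρ) - ρ / 8) ρ :=
    ((contDiffAt_const.div (contDiffAt_const.mul contDiffAt_id) (by simpa using hρ)).sub
      (contDiffAt_id.div contDiffAt_const (by norm_num)))
  exact h

/-- `B⁻¹` is smooth. [folklore] -/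
theorem contDiff_profBinv : ContDiff ℝ ∞ profBinv := by
  refine ContDiff.sub ?_ (contDiff_const.mul contDiff_id)
  exact (contDiff_const.mul (contDiff_id.pow 2) |>.add contDiff_const).sqrt fun s => by positivity

/-! ### §3 The map `H : ℝ³ ∖ 0 → S² × S¹`, `x ↦ (x/‖x‖, P (B ‖x‖))` -/

/-- A nonzero vector is its norm times its radial projection `GluckUnknot.sphereProj`
(`x ↦ x/‖x‖`, the tree's radial projection `ℝ³ → S²`). [folklore] -/
theorem norm_smul_coe_sphereProj {x : 𝔼 3} (hx : x ≠ 0) : ‖x‖ • (sphereProj x : 𝔼 3) = x := by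
  rw [coe_sphereProj hx, NormedSpace.normalize, smul_smul, mul_inv_cancel₀ (norm_ne_zero_iff.2 hx),
    one_smul]

/-- The radial projection is `C^∞` off the origin (as a map into `S²`). [folklore] -/
theorem contMDiffOn_sphereProj : ContMDiffOn 𝓘(ℝ, 𝔼 3) (𝓡 2) ∞ sphereProj {x | x ≠ 0} := by
  apply contMDiffOn_sphere_of_coe isOpen_ne
  exact (contDiffOn_normalize.contMDiffOn).congr fun x hx ↦ coe_sphereProj hx

/-- **The model map `H : ℝ³ → S² × S¹`, `H x = (x/‖x‖, P (B ‖x‖))`** (junk value at `0`):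
the direction and the reparametrised radius. [cite: Kosinski1993, VI §9] -/
def modelHFun (x : 𝔼 3) : (𝕊 2) × (𝕊 1) := (sphereProj x, cirP (profB ‖x‖))

/-- The inverse `(u, p) ↦ B⁻¹ (S p) • u` of `H`. [folklore] -/
def modelHInv (w : (𝕊 2) × (𝕊 1)) : 𝔼 3 := profBinv (cirS (w.2 : 𝔼 2)) • (w.1 : 𝔼 3)

/-- The first component of `H` is the direction. [folklore] -/
@[simp] theorem modelHFun_fst (x : 𝔼 3) : (modelHFun x).1 = sphereProj x := rfl
/-- The second component of `H` is `P (B ‖x‖)`. [folklore] -/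
@[simp] theorem modelHFun_snd (x : 𝔼 3) : (modelHFun x).2 = cirP (profB ‖x‖) := rfl

/-- `H⁻¹ (H x) = x` for `x ≠ 0`. [folklore] -/
theorem modelHInv_modelHFun {x : 𝔼 3} (hx : x ≠ 0) : modelHInv (modelHFun x) = x := by
  rw [modelHInv, modelHFun_snd, modelHFun_fst, coe_cirP, cirS_cirA,
    profBinv_profB (norm_pos_iff.2 hx), norm_smul_coe_sphereProj hx]

/-- `H⁻¹ w ≠ 0`. [folklore] -/
theorem modelHInv_ne_zero (w : (𝕊 2) × (𝕊 1)) : modelHInv w ≠ 0 :=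
  smul_ne_zero (profBinv_pos _).ne' (ne_zero_of_mem_unit_sphere w.1)

/-- `‖H⁻¹ w‖ = B⁻¹ (S w₂)`. [folklore] -/
theorem norm_modelHInv (w : (𝕊 2) × (𝕊 1)) : ‖modelHInv w‖ = profBinv (cirS (w.2 : 𝔼 2)) := by
  rw [modelHInv, norm_smul, norm_eq_of_mem_sphere, mul_one, Real.norm_of_nonneg (profBinv_pos _).le]

/-- `H (H⁻¹ w) = w` when `w₂ ≠ (1, 0)`. [folklore] -/
theorem modelHFun_modelHInv {w : (𝕊 2) × (𝕊 1)} (hw : (w.2 : 𝔼 2) 0 ≠ 1) :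
    modelHFun (modelHInv w) = w := by
  apply Prod.ext
  · rw [modelHFun_fst, modelHInv, sphereProj_smul_coe (profBinv_pos _)]
  · apply Subtype.ext
    rw [modelHFun_snd, coe_cirP, norm_modelHInv, profB_profBinv,
      cirA_cirS (norm_eq_of_mem_sphere w.2) hw]

/-- `H x` never has second coordinate `(1, 0)`. [folklore] -/
theorem modelHFun_snd_apply_zero_ne_one (x : 𝔼 3) : ((modelHFun x).2 : 𝔼 2) 0 ≠ 1 :=
  (cirA_apply_zero_lt_one _).ne

/-- `H` is smooth off the origin. [folklore] -/
theorem contMDiffOn_modelHFun :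
    ContMDiffOn 𝓘(ℝ, 𝔼 3) ((𝓡 2).prod (𝓡 1)) ∞ modelHFun {x | x ≠ 0} := by
  refine contMDiffOn_sphereProj.prodMk ?_
  have h1 : ContDiffOn ℝ ∞ (fun x : 𝔼 3 => profB ‖x‖) {x | x ≠ 0} := fun x hx =>
    ((contDiffAt_profB (norm_ne_zero_iff.2 hx)).comp x (contDiffAt_norm ℝ hx)).contDiffWithinAt
  exact contMDiff_cirP.comp_contMDiffOn h1.contMDiffOn

/-- The set `{w | w₂ ≠ (1, 0)}` is open. [folklore] -/
theorem isOpen_snd_ne_pole : IsOpen {w : (𝕊 2) × (𝕊 1) | (w.2 : 𝔼 2) 0 ≠ 1} := by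
  have hc : Continuous fun w : (𝕊 2) × (𝕊 1) => (w.2 : 𝔼 2) 0 :=
    (EuclideanSpace.proj (0 : Fin 2) : 𝔼 2 →L[ℝ] ℝ).continuous.comp
      (continuous_subtype_val.comp continuous_snd)
  exact isOpen_ne_fun hc continuous_const

/-- `H⁻¹` is smooth on `{w | w₂ ≠ (1, 0)}`. [folklore] -/
theorem contMDiffOn_modelHInv :
    ContMDiffOn ((𝓡 2).prod (𝓡 1)) 𝓘(ℝ, 𝔼 3) ∞ modelHInv {w | (w.2 : 𝔼 2) 0 ≠ 1} := by
  have h2 : ContMDiff ((𝓡 2).prod (𝓡 1)) 𝓘(ℝ, 𝔼 2) ∞ fun w : (𝕊 2) × (𝕊 1) => (w.2 : 𝔼 2) :=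
    contMDiff_coe_sphere.comp contMDiff_snd
  have h1 : ContMDiff ((𝓡 2).prod (𝓡 1)) 𝓘(ℝ, 𝔼 3) ∞ fun w : (𝕊 2) × (𝕊 1) => (w.1 : 𝔼 3) :=
    contMDiff_coe_sphere.comp contMDiff_fst
  have h3 : ContMDiffOn ((𝓡 2).prod (𝓡 1)) 𝓘(ℝ, ℝ) ∞
      (fun w : (𝕊 2) × (𝕊 1) => profBinv (cirS (w.2 : 𝔼 2))) {w | (w.2 : 𝔼 2) 0 ≠ 1} := by
    intro w hw
    have hd : ContDiffAt ℝ ∞ (fun p : 𝔼 2 => profBinv (cirS p)) (w.2 : 𝔼 2) :=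
      contDiff_profBinv.contDiffAt.comp _ (contDiffAt_cirS hw)
    exact hd.contMDiffAt.comp_contMDiffWithinAt w (h2 w).contMDiffWithinAt
  exact h3.smul h1.contMDiffOn

/-- **`H` as a partial diffeomorphism `ℝ³ ⇀ S² × S¹`** with source `ℝ³ ∖ 0` and target
`{w | w₂ ≠ (1, 0)}`. [cite: Kosinski1993, VI §9] -/
def modelH : OpenPartialHomeomorph (𝔼 3) ((𝕊 2) × (𝕊 1)) where
  toFun := modelHFun
  invFun := modelHInv
  source := {x | x ≠ 0}
  target := {w | (w.2 : 𝔼 2) 0 ≠ 1}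
  map_source' x _ := modelHFun_snd_apply_zero_ne_one x
  map_target' w _ := modelHInv_ne_zero w
  left_inv' _ hx := modelHInv_modelHFun hx
  right_inv' _ hw := modelHFun_modelHInv hw
  open_source := isOpen_ne
  open_target := isOpen_snd_ne_pole
  continuousOn_toFun := contMDiffOn_modelHFun.continuousOn
  continuousOn_invFun := contMDiffOn_modelHInv.continuousOn

/-- `modelH` acts as `H`. [folklore] -/
@[simp] theorem modelH_apply (x : 𝔼 3) : modelH x = modelHFun x := rfl
/-- `modelH.symm` acts as `H⁻¹`. [folklore] -/
@[simp] theorem modelH_symm_apply (w : (𝕊 2) × (𝕊 1)) : modelH.symm w = modelHInv w := rfl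
/-- The source of `modelH` is `ℝ³ ∖ 0`. [folklore] -/
theorem modelH_source : modelH.source = {x | x ≠ 0} := rfl
/-- The target of `modelH` is `{w | w₂ ≠ (1, 0)}`. [folklore] -/
theorem modelH_target : modelH.target = {w | (w.2 : 𝔼 2) 0 ≠ 1} := rfl

/-- `H` is smooth on its source. [folklore] -/
theorem contMDiffOn_modelH : ContMDiffOn 𝓘(ℝ, 𝔼 3) ((𝓡 2).prod (𝓡 1)) ∞ modelH modelH.source :=
  contMDiffOn_modelHFun

/-- `H⁻¹` is smooth on its target. [folklore] -/
theorem contMDiffOn_modelH_symm :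
    ContMDiffOn ((𝓡 2).prod (𝓡 1)) 𝓘(ℝ, 𝔼 3) ∞ modelH.symm modelH.target :=
  contMDiffOn_modelHInv

end ZeroSphereModel

end Literature.Topology.FourManifolds
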